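import Literature.Dynamics.Hyperbolic.ChowLinPalmerShadowing

/-!
# The Anosov closing lemma near a Chow–Lin–Palmer hyperbolic set, from shadowing with uniqueness

Topic `Literature/Dynamics/Hyperbolic`.  The classical corollary "shadowing with uniqueness ⟹ closing of returns" (Anosov's
closing lemma; Pilyugin 1999 §1.3.4, Steinlein–Walther 1990: the periodic points of symbolic dynamics near a hyperbolic set), for a
`C¹` self-map `ψ` of a Banach space and a positively invariant set `T` carrying a Chow–Lin–Palmer hyperbolic structure
(`IsCLPHyperbolicSet ψ T P Q N λ Δ`, file `ChowLinPalmerShadowing.lean`), CONDITIONAL on the named fact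
`ChowLinPalmerShadowing` (the Chow–Lin–Palmer shadowing lemma, Pilyugin1999 §1.3.4 (1.86)–(1.90); its discharge is in progress in the
tree):

* `periodicPseudoOrbit ψ x n` — the `n`-periodic sequence `k ↦ ψ^[k mod n] x` (the orbit segment `x, ψx, …, ψ^{n-1}x` repeated), and its
  bookkeeping: it stays in `T` for `x ∈ T`, it is `n`-periodic, and it is a `d`-pseudo-orbit as soon as the return defect `‖ψ^[n] x − x‖`
  is `≤ d` (the only jumps are at the wraps);
* `anosov_closing_of_chowLinPalmerShadowing` — for every `ε ∈ (0, ε₀)` there is `d > 0` such that every point `x ∈ T` returning at time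
  `n ≥ 1` within `d` of itself (`‖ψ^[n] x − x‖ ≤ d`) is `ε`-shadowed along `0 ≤ k < n` by a genuine PERIODIC point `z`, `ψ^[n] z = z`
  (the unique shadow of the periodic pseudo-orbit is periodic: `periodic_of_existsUnique_shadow`).

This is the UNIFORM counterpart of Katok's closing lemma for hyperbolic measures (the non-uniform version is the registered stub
`stub_ambientClosing` of the Navier–Stokes line `ergodic-budget-selection-closing`, crux `DenseLoudDesignerForces` of
`Summits/AnomalousDissipation`); it is what a uniformly-hyperbolic ("Axiom A", Gallavotti–Cohen) variant of that line's residual would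
use, and what the sibling line `homoclinic-excursion-trains` uses on the hyperbolic set of a transversal homoclinic loop.
Everything here is proved; the only hypothesis taken on faith is the named fact `ChowLinPalmerShadowing`.

## References

* S. Yu. Pilyugin, *Shadowing in Dynamical Systems*, LNM 1706 (1999), §1.3.4 (Chow–Lin–Palmer, Steinlein–Walther; periodic points of
  symbolic dynamics). [Pilyugin1999]
-/

noncomputable section

open Set Function Metric

namespace Literature.Dynamics.Hyperbolic

universe u

section PeriodicPseudoOrbit

variable {E : Type*}

/-- The `n`-periodic repetition `k ↦ ψ^[k mod n] x` of the orbit segment `x, ψ x, …, ψ^{n-1} x` (for `n = 0` the junk value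
`ψ^[(k mod 0).toNat] x`). [folklore] -/
def periodicPseudoOrbit (ψ : E → E) (x : E) (n : ℕ) (k : ℤ) : E :=
  ψ^[(k % (n : ℤ)).toNat] x

/-- The periodic pseudo-orbit is `n`-periodic. [folklore] -/
theorem periodicPseudoOrbit_add (ψ : E → E) (x : E) (n : ℕ) (k : ℤ) :
    periodicPseudoOrbit ψ x n (k + n) = periodicPseudoOrbit ψ x n k := by
  simp only [periodicPseudoOrbit, Int.add_emod_right]

/-- At time `0` the periodic pseudo-orbit is `x`. [folklore] -/
theorem periodicPseudoOrbit_zero (ψ : E → E) (x : E) (n : ℕ) : periodicPseudoOrbit ψ x n 0 = x := by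
  simp [periodicPseudoOrbit]

/-- On `0 ≤ k < n` the periodic pseudo-orbit is the orbit segment: `ψ^[k] x`. [folklore] -/
theorem periodicPseudoOrbit_natCast (ψ : E → E) (x : E) {n k : ℕ} (hk : k < n) :
    periodicPseudoOrbit ψ x n k = ψ^[k] x := by
  simp only [periodicPseudoOrbit]
  rw [Int.emod_eq_of_lt (by exact_mod_cast Nat.zero_le k) (by exact_mod_cast hk), Int.toNat_natCast]

/-- The periodic pseudo-orbit of a point of a positively invariant set stays in the set. [folklore] -/
theorem periodicPseudoOrbit_mem {ψ : E → E} {T : Set E} (hT : MapsTo ψ T T) {x : E} (hx : x ∈ T) (n : ℕ) (k : ℤ) :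
    periodicPseudoOrbit ψ x n k ∈ T := by
  simp only [periodicPseudoOrbit]
  exact (hT.iterate _) hx

/-- **Pseudo-orbit error of the periodic repetition**: if `n ≥ 1` and the return defect `‖ψ^[n] x − x‖ ≤ d` (`d ≥ 0`), then
`k ↦ ψ^[k mod n] x` is a `d`-pseudo-orbit (inside a period the steps are exact; at a wrap the step is `ψ(ψ^{n-1}x) = ψ^n x` versus `x`).
[folklore] -/
theorem isPseudoOrbit_periodicPseudoOrbit [NormedAddCommGroup E] {ψ : E → E} {x : E} {n : ℕ} (hn : 0 < n) {d : ℝ} (hd : 0 ≤ d)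
    (hret : ‖ψ^[n] x - x‖ ≤ d) : IsPseudoOrbit ψ d (periodicPseudoOrbit ψ x n) := by
  intro k
  simp only [periodicPseudoOrbit]
  have hn0 : (n : ℤ) ≠ 0 := by exact_mod_cast hn.ne'
  have hnpos : (0 : ℤ) < n := by exact_mod_cast hn
  set r : ℤ := k % (n : ℤ) with hr
  have hr0 : 0 ≤ r := Int.emod_nonneg _ hn0
  have hrn : r < n := Int.emod_lt_of_pos _ hnpos
  -- `r.toNat` is a natural number `< n`
  obtain ⟨m, hm⟩ : ∃ m : ℕ, (m : ℤ) = r := ⟨r.toNat, Int.toNat_of_nonneg hr0⟩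
  have hmn : m < n := by exact_mod_cast (hm ▸ hrn)
  have htoNat : r.toNat = m := by rw [← hm, Int.toNat_natCast]
  rw [htoNat]
  by_cases hlast : m + 1 < n
  · -- exact step inside the period
    have h1 : (k + 1) % (n : ℤ) = (m + 1 : ℕ) := by
      have : (k + 1) % (n : ℤ) = (r + 1) % (n : ℤ) := by
        rw [hr, Int.emod_add_emod]
      rw [this, ← hm]
      push_cast
      exact Int.emod_eq_of_lt (by positivity) (by exact_mod_cast hlast)
    rw [h1, Int.toNat_natCast, Function.iterate_succ_apply', sub_self, norm_zero]
    exact hd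
  · -- the wrap: `m = n - 1`, next index is `0 mod n`
    have hm1 : m + 1 = n := by omega
    have h1 : (k + 1) % (n : ℤ) = 0 := by
      have : (k + 1) % (n : ℤ) = (r + 1) % (n : ℤ) := by
        rw [hr, Int.emod_add_emod]
      rw [this, ← hm]
      have : ((m : ℤ) + 1) = (n : ℤ) := by exact_mod_cast hm1
      rw [this, Int.emod_self]
    rw [h1, Int.toNat_zero, Function.iterate_zero, id_eq, ← Function.iterate_succ_apply' ψ m x]
    rw [show m.succ = n from hm1]
    exact hret

end PeriodicPseudoOrbit

/-- **The Anosov closing lemma near a Chow–Lin–Palmer hyperbolic set (conditional on the Chow–Lin–Palmer shadowing lemma).**  Let `ψ` be a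
`C¹` self-map of a real Banach space and `T` a positively invariant set with a Chow–Lin–Palmer hyperbolic structure.  Then there is
`ε₀ > 0` such that for every `ε ∈ (0, ε₀)` some `d > 0` closes every `d`-return: if `x ∈ T`, `n ≥ 1` and `‖ψ^[n] x − x‖ ≤ d`, there is a
PERIODIC point `z`, `ψ^[n] z = z`, whose orbit `ε`-shadows the segment, `‖ψ^[k] z − ψ^[k] x‖ ≤ ε` for `k < n` (shadow the `n`-periodic
pseudo-orbit `ψ^[k mod n] x`; the unique shadow is `n`-periodic). [cite: Pilyugin1999, §1.3.4 (periodic points near a hyperbolic set via shadowing with uniqueness)] -/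
theorem anosov_closing_of_chowLinPalmerShadowing (hCLP : ChowLinPalmerShadowing.{u})
    {E : Type u} [NormedAddCommGroup E] [NormedSpace ℝ E] [CompleteSpace E]
    {ψ : E → E} {T : Set E} {P Q : E → E →L[ℝ] E} {N lam Δ : ℝ} (h : IsCLPHyperbolicSet ψ T P Q N lam Δ) :
    ∃ ε₀ : ℝ, 0 < ε₀ ∧ ∀ ε : ℝ, 0 < ε → ε < ε₀ → ∃ d : ℝ, 0 < d ∧
      ∀ x ∈ T, ∀ n : ℕ, 0 < n → ‖ψ^[n] x - x‖ ≤ d →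
        ∃ z : E, ψ^[n] z = z ∧ ∀ k : ℕ, k < n → ‖ψ^[k] z - ψ^[k] x‖ ≤ ε := by
  obtain ⟨ε₀, hε₀, hsh⟩ := hCLP E ψ T P Q N lam Δ h
  refine ⟨ε₀, hε₀, fun ε hε hεε₀ => ?_⟩
  obtain ⟨d, hd, hshadow⟩ := hsh ε hε hεε₀
  refine ⟨d, hd, fun x hx n hn hret => ?_⟩
  -- shadow the periodic pseudo-orbit
  set y : ℤ → E := periodicPseudoOrbit ψ x n with hy
  have hyT : ∀ k, y k ∈ T := fun k => periodicPseudoOrbit_mem h.mapsTo hx n k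
  have hyps : IsPseudoOrbit ψ d y := isPseudoOrbit_periodicPseudoOrbit hn hd.le hret
  have hyper : ∀ k, y (k + n) = y k := fun k => periodicPseudoOrbit_add ψ x n k
  obtain ⟨w, hworb, hwsh, hwper⟩ := periodic_of_existsUnique_shadow hyper (hshadow y hyT hyps)
  refine ⟨w 0, ?_, fun k hk => ?_⟩
  · -- `ψ^[n] (w 0) = w n = w 0`
    have h1 := hworb.apply_add_natCast 0 n
    rw [zero_add] at h1
    rw [← h1]
    have h2 := hwper 0
    rwa [zero_add] at h2
  · have h1 := hworb.apply_add_natCast 0 k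
    rw [zero_add] at h1
    rw [← h1, ← periodicPseudoOrbit_natCast ψ x hk]
    exact hwsh k

end Literature.Dynamics.Hyperbolic

end
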